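import Summits.ResolutionOfSingularities.ResolutionOfSingularities.Theorems.PurelyInseparableDim4ResConeFourWeights
import HarnessLib
import HarnessLib.Audit.Tags

/-!
# Purely inseparable four-folds — THE SHADE-`(p − 1)` WEIGHT AUTOMATON AT EVERY PRIME `p`: law, floor, isolation bounds, and the
# LIGHT-PAIR / EVENTUALLY-HEAVY DICHOTOMY (K2(p) lane, SLICE C, the `(p, p−1)` rung after K2(5); file-holder res-dim4-p-5 g5)

[OURS · counted 0 · cell `res-dim4-pi` · K2(p) lane, slice C (general-`p` programme, desk WORD #188 (a): the `(p, p−1)` rung's three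
branches) · seat p-5 g5.]  Nothing here proves K2(p) for any `p`, `NoIsolatedTrap p p` or resolution of singularities in dimension
≥ 4 / characteristic `p` — NOT proved; pure `(r, j, b)` bookkeeping plus the chain dress.  AI kernel work, weaker than expert review.

The holder's W₄ (`…ResConeFourWeights`, p702207) runs the weight automaton of a constant-shade-`4` tail at `p = 5`: new weight
`|r_k| − 1`, floor `|r_k| ≥ 2`, pair bound `3`.  Its CORE (`weights_dichotomy₄`, `two_le_succ`, `two_le_from`) never mentions `5`:
the law «newborn weighs `|r_k| − 1`» is the law of shade `d = p − 1` at EVERY prime `p` (`o_k = |r_k| + p − 1`, newborn `o_k − p`).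
This file is the general-`p` DRESS:
* **`prime_weights_laws (p)`** — on a witnessed isolated above-floor `Step0 p` chain with `x^{r₀} ∣ F₀` and constant shade `p − 1` from
  `k₀`: `ord₀ F_k = |r_k| + (p − 1)`, the boundary law `r_{k+1} = (r_k|_{b_k = 0}).update (j k) (|r_k| − 1)`, `b k (j k) = 0`, the floor
  `2 ≤ |r_k|`, the band `|r_k| ≤ p − 1`, and the ISOLATION BOUNDS `r_k i ≤ p − 2`, `r_k i + r_k i′ ≤ p − 2` (`i ≠ i′`)
  (`IsolatedBand.apply_le_of_isIsolated`, `…MultiplicityPairs.apply_add_apply_le_of_isIsolated`, every `k`);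
* **`weights_dichotomy_prime (p)`** — EITHER every `k ≥ k₀` is the LIGHT PAIR (weights `≤ 1`, `|r_k| = 2`) OR from some `k₁ ≥ k₀` on
  every state is HEAVY (some weight `≥ 2`) — W₄'s `weights_dichotomy₄` verbatim;
* `heavy_from_prime (p)` — heaviness is absorbing (W₄'s `two_le_from`).
With res-dim4-p-5 g5's `no_light_pair_tail_prime` (`…LightPairAllPrimes`, every prime) the light branch is EMPTY when `e_G ≡ 2`, so
every `(p, p−1)` binary-cone tail is eventually heavy; at `p = 5` heavy = D∞ (pair bound `3`), at `p ≥ 7` the heavy class is wider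
((2,2), (3), (3,2), (4), (2,1,1), … under pair bound `p − 2`, triple bound `p − 1`).
[cite: CossartJannsenSaito2020, Thm. 3.14, Lemma 13.2] [cite: HauserPerlega2019PRIMS, §2 (transform D′ of D)]
bears_on: LADDER-RESOLUTION:D157-DOOR2 (res-dim4-pi · K2(p) = `RidgeBudget.NoAboveFloorTrap p p` · slice C `(p, p−1)` weights).
Supports stmt-ResolutionOfSingularities-16155 (helper).
-/

set_option linter.dupNamespace false -- mandated namespace of this single-conjunct summit

noncomputable section

namespace Summit.ResolutionOfSingularities.ResolutionOfSingularities.Theorems.PIDim4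

namespace ResCone

open MvPolynomial Finset
open Literature.AlgebraicGeometry.Resolution
open Literature.AlgebraicGeometry.Resolution.CentreBlowup
open Literature.AlgebraicGeometry.Resolution.Hauser2010
open Literature.AlgebraicGeometry.Resolution.HauserPerlega2019

variable {K : Type} [Field K] [DecidableEq K] (p : ℕ) [Fact p.Prime]

/-- **THE SHADE-`(p − 1)` LAWS AT THE PRIME `p`.**  On a witnessed isolated above-floor `Step0 p` chain with `x^{r₀} ∣ F₀` and constant
shade `d = p − 1` from `k₀`: `ord₀ F_k = |r_k| + d`, the boundary law with newborn weight `|r_k| − 1`, `b k (j k) = 0`, the floor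
`2 ≤ |r_k|`, the band `|r_k| ≤ d`, and the isolation bounds `r_k i ≤ p − 2`, `r_k i + r_k i′ ≤ p − 2` (`i ≠ i′`, every `k`).
[OURS · bookkeeping] [cite: CossartJannsenSaito2020, Thm. 3.14, Lemma 13.2] [cite: HauserPerlega2019PRIMS, §2 (transform D′ of D)] -/
theorem prime_weights_laws {c : ℕ → State K} {j : ℕ → Fin 4} {b : ℕ → Fin 4 → K}
    (hc : ∀ k, IsIsolated p (c k).F ∧ Step0 p (c k) (c (k + 1))) (hw : FreeTail.IsWitnessedChain p c j b)
    (hr0 : ∀ e ∈ (c 0).F.support, (c 0).r ≤ e) (hfloor : ∀ k, ordZero (c k).F ≠ p) {k₀ d : ℕ} (hd : d + 1 = p)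
    (hshade : ∀ k, k₀ ≤ k → (c k).shade = (d : ℕ∞)) :
    (∀ k, k₀ ≤ k → ordZero (c k).F = (((c k).r.degree + d : ℕ) : ℕ∞)) ∧
    (∀ k, k₀ ≤ k →
      (c (k + 1)).r = ((c k).r.filter (fun i => b k i = 0)).update (j k) ((c k).r.degree - 1)) ∧
    (∀ k, b k (j k) = 0) ∧ (∀ k, k₀ ≤ k → 2 ≤ (c k).r.degree) ∧ (∀ k, k₀ ≤ k → (c k).r.degree ≤ d) ∧
    (∀ k i, (c k).r i ≤ p - 2) ∧ (∀ k i i', i ≠ i' → (c k).r i + (c k).r i' ≤ p - 2) := by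
  have hp2 : 2 ≤ p := (Fact.out : p.Prime).two_le
  have hdivk : ∀ k, ∀ e ∈ (c k).F.support, (c k).r ≤ e := IsolatedBand.isolated_chain_forall_le hc hr0
  have hord : ∀ k, k₀ ≤ k → ordZero (c k).F = (((c k).r.degree + d : ℕ) : ℕ∞) ∧ 2 ≤ (c k).r.degree ∧
      (c k).r.degree ≤ d := by
    intro k hk
    obtain ⟨o, ho, hpo, -, hod⟩ := chain_shade_nat p hc hfloor hshade hk
    obtain ⟨o', ho', -, ho'2⟩ := BandShade.exists_ordZero_eq p hc k
    have hoo' : o = o' := by have h := ho.symm.trans ho'; exact_mod_cast h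
    have hro := degree_r_le ho (hdivk k)
    refine ⟨?_, by omega, by omega⟩
    rw [ho]; congr 1; omega
  refine ⟨fun k hk => (hord k hk).1, fun k hk => ?_, fun k => (hw k).2.1, fun k hk => (hord k hk).2.1,
    fun k hk => (hord k hk).2.2, fun k i => ?_, fun k i i' hii' => ?_⟩
  · rw [(hw k).2.2.2.2, step_r_univ' p (j k) (b k) (c k) (hord k hk).1]
    congr 1
    omega
  · exact IsolatedBand.apply_le_of_isIsolated hp2 (hc k).1 (hdivk k) i
  · exact IsolatedBand.apply_add_apply_le_of_isIsolated hp2 (hc k).1 (hdivk k) hii'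

/-- **THE SHADE-`(p − 1)` WEIGHTS DICHOTOMY AT EVERY PRIME `p`**: along a witnessed isolated above-floor `Step0 p` chain with
`x^{r₀} ∣ F₀` and constant shade `p − 1` from `k₀`, EITHER every `k ≥ k₀` is the LIGHT PAIR (weights `≤ 1`, `|r_k| = 2`), OR from some
`k₁ ≥ k₀` on every state has a letter of weight `≥ 2` (W₄'s core `weights_dichotomy₄`, whose law is the shade-`(p−1)` law). [OURS]
[cite: CossartJannsenSaito2020, Thm. 3.14] -/
theorem weights_dichotomy_prime {c : ℕ → State K} {j : ℕ → Fin 4} {b : ℕ → Fin 4 → K}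
    (hc : ∀ k, IsIsolated p (c k).F ∧ Step0 p (c k) (c (k + 1))) (hw : FreeTail.IsWitnessedChain p c j b)
    (hr0 : ∀ e ∈ (c 0).F.support, (c 0).r ≤ e) (hfloor : ∀ k, ordZero (c k).F ≠ p) {k₀ d : ℕ} (hd : d + 1 = p)
    (hshade : ∀ k, k₀ ≤ k → (c k).shade = (d : ℕ∞)) :
    (∀ k, k₀ ≤ k → (∀ i, (c k).r i ≤ 1) ∧ (c k).r.degree = 2) ∨
    (∃ k₁, k₀ ≤ k₁ ∧ ∀ k, k₁ ≤ k → ∃ W, 2 ≤ (c k).r W) := by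
  obtain ⟨-, hlaw, hbj, hfl, -⟩ := prime_weights_laws p hc hw hr0 hfloor hd hshade
  exact weights_dichotomy₄ hlaw hbj hfl

/-- **HEAVINESS IS ABSORBING** at shade `p − 1`: a state `k₁ ≥ k₀` with a letter of weight `≥ 2` is followed for ever by such states
(W₄'s `two_le_from`). [OURS] [cite: CossartJannsenSaito2020, Thm. 3.14] -/
theorem heavy_from_prime {c : ℕ → State K} {j : ℕ → Fin 4} {b : ℕ → Fin 4 → K}
    (hc : ∀ k, IsIsolated p (c k).F ∧ Step0 p (c k) (c (k + 1))) (hw : FreeTail.IsWitnessedChain p c j b)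
    (hr0 : ∀ e ∈ (c 0).F.support, (c 0).r ≤ e) (hfloor : ∀ k, ordZero (c k).F ≠ p) {k₀ d : ℕ} (hd : d + 1 = p)
    (hshade : ∀ k, k₀ ≤ k → (c k).shade = (d : ℕ∞)) {k₁ : ℕ} (hk₁ : k₀ ≤ k₁) (hheavy : ∃ W, 2 ≤ (c k₁).r W) :
    ∀ k, k₁ ≤ k → ∃ W, 2 ≤ (c k).r W := by
  obtain ⟨-, hlaw, hbj, hfl, -⟩ := prime_weights_laws p hc hw hr0 hfloor hd hshade
  exact two_le_from hlaw hbj hfl hk₁ hheavy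

/-- **THE LIGHT PAIR FORCES SHADE `p − 1`**: conversely, on a constant-shade-`d` tail (`d < p`) whose boundary is a light pair from
`k₀`, `d + 1 = p` (the newborn letter must weigh `1 = |r| + d − p`). [OURS · bookkeeping] [cite: HauserPerlega2019PRIMS, §2 (transform D′ of D)] -/
theorem shade_eq_of_light_pair {c : ℕ → State K} {j : ℕ → Fin 4} {b : ℕ → Fin 4 → K}
    (hc : ∀ k, IsIsolated p (c k).F ∧ Step0 p (c k) (c (k + 1))) (hw : FreeTail.IsWitnessedChain p c j b)
    (hfloor : ∀ k, ordZero (c k).F ≠ p) {k₀ d : ℕ} (hshade : ∀ k, k₀ ≤ k → (c k).shade = (d : ℕ∞))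
    (hwt : ∀ k, k₀ ≤ k → (∀ i, (c k).r i ≤ 1) ∧ (c k).r.degree = 2) : d + 1 = p := by
  obtain ⟨o, ho, hpo, ho2, hod⟩ := chain_shade_nat p hc hfloor hshade (le_refl k₀)
  have h2 := (hwt k₀ le_rfl).2
  have hnew := (hwt (k₀ + 1) (by omega)).1 (j k₀)
  rw [(hw k₀).2.2.2.2, step_r_univ' p (j k₀) (b k₀) (c k₀) ho, Finsupp.coe_update, Function.update_self] at hnew
  omega

end ResCone

end Summit.ResolutionOfSingularities.ResolutionOfSingularities.Theorems.PIDim4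

end
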